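import Literature.Probability.LatticeModels.MedialInterface
import Literature.Probability.LatticeModels.PolylineWinding
import HarnessLib

/-!
# Winding of a medial path and the passage sum of the parafermionic observable (fact-free home)

Topic `Literature/Probability/LatticeModels`; definition request `defn-ZdDiscretisationFamily-2`
(route repair of `CriticalPhenomena/CardyFormulaZ2/CardyComplexCone`, serving the seven
`CardyFormulaZ2` routes that imported `FermionicObservable.lean` only for this vocabulary:
`CardyComplexCone`, `CardySusyWard`, `CardyWindingIG`, `CardyDualCurrent`,
`CardySublatticeCoherence`, `CardyViaSLE6`, `CardyRotToConf`).

The *winding* `W_γ(z)` of the medial exploration path `γ` of a discrete Dobrushin domain up to a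
passage through a medial vertex `z`, and the *passage sum*
`∑_{passages of γ through z} exp (-i σ W_γ(z))` whose expectation is Smirnov's (para)fermionic
observable `F(z) = E[χ_{z ∈ γ} exp (-i σ W(γ, b → z))]` (S. Smirnov, *Conformal invariance in
random cluster models. I*, Ann. of Math. 172 (2010), §2.2, eq. (2.2); spin
`σ = 1 - (2/π) arccos (√q / 2)`, so `σ = 1/3` for critical bond percolation `q = 1` and `σ = 1/2`
for FK-Ising; D. Chelkak, S. Smirnov, Invent. Math. 189 (2012), §2.2, for the sum over all
passages). This is pure polyline / medial-path combinatorics: nothing here depends on a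
probability measure or on a lattice model.

## Contents (namespace `Literature.Probability.LatticeModels.MedialPath`, exported to
`Literature.Probability.LatticeModels`)

* `windingAt γ δ k` — the winding at mesh `δ` of the medial path `γ : List MedialVertex` from its
  start up to its `k`-th entry (average of the polyline windings on arrival and on departure);
* `windingUpTo γ δ z` — the winding up to the *first* passage through `z`; `windingAt_idxOf`;
* `passageSum γ δ spin z` — `∑_{k < |γ|, γ[k] = z} exp (-i · spin · windingAt γ δ k)`;
  `passageSum_eq_zero_of_not_mem`.

## Why this file exists, and how the old names keep working

This is the block "winding at a medial vertex / the contribution of one path to the observable"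
of `Literature/Probability/LatticeModels/FermionicObservable.lean` (its declarations `windingAt`,
`windingUpTo`, `windingAt_idxOf`, `passageSum`, `passageSum_eq_zero_of_not_mem`), reproduced
**verbatim** — same bodies, same statements, same junk values — except that the polyline winding
is taken from the Mathlib-only module `PolylineWinding.lean` (`Polyline.winding`, itself the
verbatim copy of `FermionicObservable`'s `winding`), so that this module imports only
`MedialInterface` (G02's `MedialVertex`, `medialPoint`, `medialExploration`; every named fact of
that file is discharged) and `PolylineWinding`: its Literature import closure contains **no
unproved named fact**, whereas `FermionicObservable.lean` carries the FK-Ising fact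
`isSHolomorphic_fkIsingObservable` (Smirnov 2010, Lemma 4.4) and the random-cluster imports,
all irrelevant to bond percolation. A route file that needs the `q = 1`, spin-`1/3` parafermionic
observable of the percolation exploration path writes
`∫ ω, passageSum (medialExploration (E δ) ω) δ (1/3) z ∂(bondPercolation (zdGraph 2) half)`
against this module (`medialExploration` is the definiens of `FermionicObservable`'s `abbrev
fkInterface`).

Same mechanism as `PolylineWinding.lean`: the declarations live in the sub-namespace
`…LatticeModels.MedialPath` (one fully-qualified name, one module — `FermionicObservable` still
declares `…LatticeModels.windingAt` etc. itself), and the `export MedialPath (…)` command at the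
end registers the OLD names `Literature.Probability.LatticeModels.windingAt`, `….windingUpTo`,
`….windingAt_idxOf`, `….passageSum`, `….passageSum_eq_zero_of_not_mem` as *aliases* (Lean's alias
table travels with `import`). Hence a file written against `FermionicObservable` — fully
qualified, under `open Literature.Probability.LatticeModels`, or inside that namespace —
elaborates UNCHANGED against this module once its import points here. A module importing **both**
this file and `FermionicObservable` sees the real constants and the aliases: fully-qualified
references then resolve to the real (`FermionicObservable`) constants, SHORT references are
reported ambiguous by Lean (an error naming both candidates, never a silent change); such a file
writes `MedialPath.passageSum`. No module does this today. The two copies agree: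
`MedialPath.windingAt = windingAt` etc. by unfolding and `Polyline.winding = winding` (proved by a
three-line induction in a bridge file importing both; not needed by the routes). The duplicate to
delete eventually is the block in `FermionicObservable.lean` (an operator-side atomic change, gate
lint `removes-referenced-decl`), **not** this file.

## Design choices and junk values (as in `FermionicObservable`)

* **Winding at a medial vertex.** The polyline through the medial vertices (edge midpoints
  `medialPoint δ e`) of `γ` turns by `±π/2` *at* every medial vertex, whereas Smirnov's smoothly
  drawn interface crosses the edge perpendicularly, in the direction bisecting that turn. Hence
  `windingAt γ δ k` is the average of the windings of the polyline prefixes ending at position `k`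
  and one step after (= winding on arrival plus half the turn there), measured from the initial
  direction at `e_a` (Smirnov measures from `b`; the two conventions differ by the constant total
  winding of the interface). For `k ≥ γ.length` it is the total winding (junk).
* **Multiple passages.** The exploration path may pass through a medial vertex twice
  (`IsMedialExploration.nodup` forbids repeated medial *edges* only); the literature's vertex
  observable sums the contributions of all passages (Chelkak–Smirnov 2012, §2.2,
  `F(z) = ½ ∑_{c ∼ z} F(c)`), and so does `passageSum` (a finite sum over the positions `k` with
  `γ[k] = z`); `windingUpTo` (first passage only, junk = total winding if `z ∉ γ`) is kept as the
  named convenience of the original file.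
* Mathlib anchors: `Complex.exp`, `List.idxOf`, `List.take`, `Finset.sum`/`Finset.filter`;
  Mathlib has no winding of polylines and no medial lattice (see `PolylineWinding`,
  `MedialInterface`).

## References

* S. Smirnov, *Conformal invariance in random cluster models. I. Holomorphic fermions in the
  Ising model*, Ann. of Math. 172 (2010) 1435–1467 (arXiv:0708.0039), §2.2: "Let `F(z)` be the
  expectation that the interface `γ` passes through a point `z` taken with a complex weight:
  `F(z) := E[χ_{z∈γ(ω)} · exp (-iσ w(γ, b → z))]`. Here `w` denotes the winding or (the total
  turn) of `γ` from `b` to `z`, measured in radians." [Smirnov2010]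
* D. Chelkak, S. Smirnov, *Universality in the 2D Ising model and conformal invariance of
  fermionic observables*, Invent. Math. 189 (2012) 515–580, §2.2. [ChelkakSmirnov2012]
-/

noncomputable section

namespace Literature.Probability.LatticeModels.MedialPath

/-! ### Winding of a medial path up to a passage -/

/-- The winding at mesh `δ` of the medial path `γ` from its start up to its `k`-th entry
(its `k`-th passage through a medial vertex): with `pts` the list of midpoints
`medialPoint δ e`, it is the average
`(winding (pts.take (k+1)) + winding (pts.take (k+2))) / 2` of the winding accumulated on
arrival at position `k` and the winding accumulated on departure — the direction of Smirnov's
smoothly drawn interface at a medial vertex, which crosses the edge perpendicularly, bisects the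
`±π/2` turn of the polyline there (see the module docstring). For `k ≥ γ.length` this is the
total winding (junk). Verbatim copy of `FermionicObservable`'s `windingAt` over
`Polyline.winding`. (Smirnov 2010, §2.2, "the winding `w(γ, b → z)` of `γ` up to `z`".)
[cite: Smirnov2010, §2.2] -/
def windingAt (γ : List MedialVertex) (δ : ℝ) (k : ℕ) : ℝ :=
  (Polyline.winding ((γ.map (medialPoint δ)).take (k + 1)) +
    Polyline.winding ((γ.map (medialPoint δ)).take (k + 2))) / 2

/-- Unfolding `windingAt`. (Smirnov 2010, §2.2.) [cite: Smirnov2010, §2.2] -/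
theorem windingAt_eq (γ : List MedialVertex) (δ : ℝ) (k : ℕ) :
    windingAt γ δ k =
      (Polyline.winding ((γ.map (medialPoint δ)).take (k + 1)) +
        Polyline.winding ((γ.map (medialPoint δ)).take (k + 2))) / 2 :=
  rfl

/-- The empty path has zero winding at every position. (Smirnov 2010, §2.2.)
[cite: Smirnov2010, §2.2] -/
@[simp] theorem windingAt_nil (δ : ℝ) (k : ℕ) : windingAt [] δ k = 0 := by
  simp [windingAt]

/-- The winding `W_γ(z)` at mesh `δ` of the medial path `γ` from its start up to its **first**
passage through the medial vertex `z`: `windingAt γ δ (γ.idxOf z)`. Junk (total winding) if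
`z ∉ γ`. Only the first passage is seen; the observable sums over all passages instead
(`passageSum`; module docstring, "Multiple passages"). Verbatim copy of `FermionicObservable`'s
`windingUpTo`. (Smirnov 2010, §2.2.) [cite: Smirnov2010, §2.2] -/
def windingUpTo (γ : List MedialVertex) (δ : ℝ) (z : MedialVertex) : ℝ :=
  windingAt γ δ (γ.idxOf z)

/-- `windingUpTo` is `windingAt` at the first passage. (Smirnov 2010, §2.2.)
[cite: Smirnov2010, §2.2] -/
theorem windingAt_idxOf (γ : List MedialVertex) (δ : ℝ) (z : MedialVertex) :
    windingAt γ δ (γ.idxOf z) = windingUpTo γ δ z := rfl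

/-! ### The contribution of one path to the (para)fermionic observable -/

/-- The contribution of one medial path `γ` (at mesh `δ`) to the (para)fermionic observable with
spin `spin` at the medial vertex `z`: the sum, over all positions `k < γ.length` with `γ[k] = z`
(all passages of `γ` through `z`), of `exp (-i · spin · windingAt γ δ k)`; `0` if `z ∉ γ`. Its
expectation under the law of the exploration path is Smirnov's observable
`F(z) = E[χ_{z ∈ γ} exp (-iσ w(γ, b → z))]` (spin `σ = 1/3` for critical bond percolation,
`q = 1`; `σ = 1/2` for FK-Ising). Verbatim copy of `FermionicObservable`'s `passageSum`.
(Smirnov 2010, §2.2, eq. (2.2), with `σ = spin`; all passages counted as in Chelkak–Smirnov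
2012, §2.2.) [cite: Smirnov2010, §2.2, eq. (2.2)] -/
def passageSum (γ : List MedialVertex) (δ spin : ℝ) (z : MedialVertex) : ℂ :=
  ∑ k ∈ (Finset.range γ.length).filter (fun k => γ[k]? = some z),
    Complex.exp (-Complex.I * spin * (windingAt γ δ k : ℝ))

/-- Unfolding `passageSum`. (Smirnov 2010, §2.2, eq. (2.2).) [cite: Smirnov2010, §2.2, eq. (2.2)] -/
theorem passageSum_eq (γ : List MedialVertex) (δ spin : ℝ) (z : MedialVertex) :
    passageSum γ δ spin z =
      ∑ k ∈ (Finset.range γ.length).filter (fun k => γ[k]? = some z),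
        Complex.exp (-Complex.I * spin * (windingAt γ δ k : ℝ)) :=
  rfl

/-- Off the path the contribution vanishes. (Smirnov 2010, §2.2.) [cite: Smirnov2010, §2.2] -/
theorem passageSum_eq_zero_of_not_mem {γ : List MedialVertex} (δ spin : ℝ) {z : MedialVertex}
    (hz : z ∉ γ) : passageSum γ δ spin z = 0 := by
  refine Finset.sum_eq_zero fun k hk => ?_
  exact absurd (List.mem_of_getElem? (Finset.mem_filter.1 hk).2) hz

/-- The empty path contributes nothing. (Smirnov 2010, §2.2.) [cite: Smirnov2010, §2.2] -/
@[simp] theorem passageSum_nil (δ spin : ℝ) (z : MedialVertex) : passageSum [] δ spin z = 0 :=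
  passageSum_eq_zero_of_not_mem δ spin (List.not_mem_nil)

end Literature.Probability.LatticeModels.MedialPath

/-! ### The historical names

`export` registers `Literature.Probability.LatticeModels.windingAt`, `….windingUpTo`,
`….windingAt_idxOf`, `….passageSum`, `….passageSum_eq_zero_of_not_mem` as aliases of the
declarations above, in this module and in every module importing it (see the module docstring;
the new lemmas `windingAt_eq`, `windingAt_nil`, `passageSum_eq`, `passageSum_nil` are reached as
`MedialPath.…`). -/

namespace Literature.Probability.LatticeModels

export MedialPath (windingAt windingUpTo windingAt_idxOf passageSum passageSum_eq_zero_of_not_mem)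

end Literature.Probability.LatticeModels

end
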